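import Literature.NumberTheory.Automorphic.IsomorphismTheoremUniqueCenterProofs
import Literature.NumberTheory.Automorphic.IsomorphismTheoremUniqueLieProofs
import Literature.NumberTheory.Automorphic.RootSubgroupUnique
import Literature.NumberTheory.Automorphic.ReductiveDualHolds
import HarnessLib

/-!
# Springer 9.6.2 (uniqueness): the named fact `isomorphismTheorem_unique` from 8.1.2 alone in
# every characteristic, and outright in characteristic `0`
(trunk T-AUTOMORPHIC, G25 AutomorphicL; proof file of `IsomorphismTheoremUnique.lean`)

`IsomorphismTheoremUnique.lean` vendors Springer, *Linear Algebraic Groups* (2nd ed.), Thm. 9.6.2,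
second assertion (p. 179) — *two isomorphisms of algebraic groups `φ, φ' : G → G₁` mapping the
maximal torus `T` onto `T₁` and inducing the same isomorphism of root data differ by `Int(t)`,
`t ∈ T`* — as the named fact `isomorphismTheorem_unique`, and `IsomorphismTheoremUniqueProofs.lean`
formalises its printed proof as `isomorphismTheorem_unique_of`: the fact for `(G, T)` (and any
`(G₁, T₁)`) follows from 7.4.3 (`exists_isRootDatumOf`), 8.1.1 (i) (`rootSubgroup_unique`) and
8.1.1 (ii) (`torus_sup_rootSubgroups_eq`) for `(G, T)`. The first two are now theorems of the tree
in every characteristic (`exists_isRootDatumOf_holds`, `ReductiveDualHolds.lean`;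
`rootSubgroup_unique_holds`, `RootSubgroupUnique.lean`), and 8.1.1 (ii) follows in every
characteristic from the named fact `lieWeights_eq_roots` (Springer 8.1.2: `P = R`, `dim 𝔤_α = 1`)
alone (`torus_sup_rootSubgroups_eq.of_lieWeights_eq_roots`, `IsomorphismTheoremUniqueCenterProofs.lean`:
the argument of 7.1.3 (i) with 5.4.7 and 7.6.4 (ii), both theorems). Hence, all proved here, no
named fact introduced and no statement of the tree changed:

* `isomorphismTheorem_unique_of_lieWeights_eq_roots` — **9.6.2 (uniqueness) from 8.1.2 alone,
  every characteristic.** The discharge `isomorphismTheorem_unique_holds` (the fact quantifies over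
  every characteristic) is `isomorphismTheorem_unique_of_lieWeights_eq_roots lieWeights_eq_roots_holds`
  once 8.1.2 is a theorem of the tree in positive characteristic; its printed proof needs the
  existence half of 7.3.3 (i) there — a root homomorphism onto the unipotent part of a Borel
  subgroup in semisimple rank one, through 7.2.3 and 3.4.9 (a connected unipotent group of
  dimension one is `𝔾ₐ`) — which the tree has in characteristic `0` only (the exponential,
  `lieWeights_subset_roots`).
* `isomorphismTheorem_unique_of_charZero` — **Springer 9.6.2 (uniqueness) over algebraically
  closed fields of characteristic `0`, with no hypothesis left** (8.1.2 in characteristic `0` is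
  `lieWeights_eq_roots.of_charZero`, `IsomorphismTheoremUniqueLieProofs.lean`), and its case
  `G₁ = G`, `φ = id`: `mulEquiv_eq_conj_of_charZero` (an automorphism of the algebraic group `G`
  fixing `T` and inducing the identity on `X*(T)` is `Int(t)`, `t ∈ T`). This supersedes the
  conditional `isomorphismTheorem_unique_of_exists_isRootDatumOf` /
  `mulEquiv_eq_conj_of_exists_isRootDatumOf` of `IsomorphismTheoremUniqueCharZero.lean`, whose
  hypothesis 7.4.3 is now `exists_isRootDatumOf_holds`.

## References

* [SpringerLAG1998] T. A. Springer, *Linear Algebraic Groups*, 2nd ed., Progress in Mathematics 9,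
  Birkhäuser (1998): Thm. 9.6.2 and its proof (p. 179), Prop. 8.1.1, Cor. 8.1.2, Lemma 7.1.3 (i),
  Lemma 7.3.3 (i), 3.4.9.
-/

noncomputable section

open scoped MatrixGroups IsMulCommutative

namespace Literature.NumberTheory.Automorphic

variable {k : Type*} [Field k] {n : Type*} [Fintype n] [DecidableEq n]
variable {n' : Type*} [Fintype n'] [DecidableEq n']
variable {G T : Subgroup (GL n k)} {G₁ T₁ : Subgroup (GL n' k)}

/-- **Springer 9.6.2 (uniqueness) from 8.1.2 alone, every characteristic**: granted the named fact
`lieWeights_eq_roots` (8.1.2) for `(G, T)`, the named fact `isomorphismTheorem_unique` holds for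
`(G, T)` and any `(G₁, T₁)` — the printed proof `isomorphismTheorem_unique_of` fed with 7.4.3
(`exists_isRootDatumOf_holds`), 8.1.1 (i) (`rootSubgroup_unique_holds`) and 8.1.1 (ii) from 8.1.2
(`torus_sup_rootSubgroups_eq.of_lieWeights_eq_roots`). [cite: SpringerLAG1998, Thm. 9.6.2 (proof)] -/
theorem isomorphismTheorem_unique_of_lieWeights_eq_roots
    (h : lieWeights_eq_roots (G := G) (T := T)) :
    isomorphismTheorem_unique (G := G) (T := T) (G₁ := G₁) (T₁ := T₁) :=
  isomorphismTheorem_unique_of exists_isRootDatumOf_holds rootSubgroup_unique_holds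
    (torus_sup_rootSubgroups_eq.of_lieWeights_eq_roots h)

/-- **Springer 9.6.2 (uniqueness) over algebraically closed fields of characteristic `0`.** Let
`G ≤ GL n k` and `G₁ ≤ GL n' k` be connected reductive over an algebraically closed field of
characteristic `0`, with maximal tori `T`, `T₁`, and let `φ, φ' : G → G₁` be isomorphisms of
algebraic groups with `φ T = φ' T = T₁` inducing the same map on `X*(T₁)`. Then `φ' = φ ∘ Int(t)`
for some `t ∈ T` — the named fact `isomorphismTheorem_unique` for `(G, T)`, `(G₁, T₁)` with no
hypothesis left: `isomorphismTheorem_unique_of_lieWeights_eq_roots` with 8.1.2 in characteristic `0`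
(`lieWeights_eq_roots.of_charZero`). (The fact itself quantifies over every characteristic;
positive characteristic awaits 8.1.2 there, see the module docstring.) [cite: SpringerLAG1998, Thm. 9.6.2] -/
theorem isomorphismTheorem_unique_of_charZero [CharZero k] :
    isomorphismTheorem_unique (G := G) (T := T) (G₁ := G₁) (T₁ := T₁) :=
  isomorphismTheorem_unique_of_lieWeights_eq_roots lieWeights_eq_roots.of_charZero

/-- **Automorphisms fixing `T` and `X*(T)` are inner from `T`, characteristic `0`** (the case
`G₁ = G`, `φ = id` of 9.6.2, as used in step 3 of Springer's proof of 9.6.2): for `G ≤ GL n k`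
connected reductive over an algebraically closed field of characteristic `0`, `T` a maximal torus
and `θ` an automorphism of the algebraic group `G` with `θ T = T` inducing the identity on `X*(T)`,
there is `t ∈ T` with `θ = Int(t)` (`isomorphismTheorem_unique.mulEquiv_eq_conj` with
`isomorphismTheorem_unique_of_charZero`). [cite: SpringerLAG1998, Thm. 9.6.2 (proof)] -/
theorem mulEquiv_eq_conj_of_charZero [IsAlgClosed k] [CharZero k] (hG : IsConnectedReductive G)
    (hT : IsMaximalTorusIn T G) (θ : ↥G ≃* ↥G)
    (hθ : MonoidHom.IsAlgebraicGL (G.subtype.comp θ.toMonoidHom))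
    (hθ' : MonoidHom.IsAlgebraicGL (G.subtype.comp θ.symm.toMonoidHom))
    (hθT : ∀ g : ↥G, ((θ g : ↥G) : GL n k) ∈ T ↔ (g : GL n k) ∈ T)
    (hχ : ∀ χ : ↥T →* kˣ, IsAlgebraicChar χ → ∀ (g : ↥G) (hg : (g : GL n k) ∈ T),
      χ ⟨((θ g : ↥G) : GL n k), (hθT g).mpr hg⟩ = χ ⟨(g : GL n k), hg⟩) :
    ∃ t : ↥G, (t : GL n k) ∈ T ∧ ∀ g : ↥G, θ g = t * g * t⁻¹ :=
  isomorphismTheorem_unique.mulEquiv_eq_conj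
    (isomorphismTheorem_unique_of_charZero (G₁ := G) (T₁ := T)) hG hT θ hθ hθ' hθT hχ

end Literature.NumberTheory.Automorphic

end
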